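import Literature.NumberTheory.BeurlingPrimes.EulerProduct
import Literature.NumberTheory.BeurlingPrimes.IntCountBasic
import Literature.NumberTheory.BeurlingPrimes.HilberdinkCounting
import Mathlib.Analysis.SpecialFunctions.ImproperIntegrals
import Mathlib.MeasureTheory.Integral.Bochner.Basic
import Mathlib.Data.Finsupp.Encodable
import HarnessLib

/-!
# Beurling integers: `∑ n^{−σ} = ∫₁^∞ N_P(x) σx^{−σ−1} dx` and convergence of `∑ n^{-σ}` from `N_P(x) ≪ x`

Topic `Literature/NumberTheory/BeurlingPrimes`. Everything in this file is PROVED. It sits on top of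
the tree's `IntCountBasic.lean` (finiteness of `{k : genInt k ≤ x}`, `intCount_mono`, …),
`HilberdinkCounting.lean` (`Hilberdink.summable_prime_rpow`: `N_P(x) ≤ Bx ⇒ ∑_j λ_j^{−σ} < ∞` for
`σ > 1`; `Hilberdink.hasSum_indicator_intCount`) and `EulerProduct.lean`
(`summable_norm_genInt_cpow`: absolute convergence of `ζ_P` from `∑_j λ_j^{−σ} < ∞`), and adds the
integer-side facts used by the Mellin representation of `ζ_P` (`IntegerMellin.lean`):

* `one_lt_genInt` — `genInt k ≥ λ₀ > 1` for `k ≠ 0`;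
* `tsum_ite_genInt_le` — `∑_k 1[genInt k ≤ x] · c = N_P(x) · c` (a `tsum` over ALL exponent vectors,
  the form Fubini consumes);
* `lintegral_ite_le_rpow`, `tsum_ofReal_genInt_rpow_eq_lintegral` — the Stieltjes/Tonelli identity
  `∑_k (genInt k)^{−σ} = ∫₁^∞ N_P(x) σ x^{−σ−1} dx` (`σ > 0`, in `ℝ≥0∞`, no convergence hypothesis:
  Montgomery–Vaughan's "`ζ_P(s) = ∫_{1⁻}^∞ u^{−s} dN(u) = s∫₁^∞ N(u)u^{−s−1} du`" for real `s = σ`);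
* `summable_genInt_rpow` — `N_P(x) ≤ Kx` (`x ≥ 1`) gives `∑_k (genInt k)^{−σ} < ∞` for `σ > 1`.

## References
* [MontgomeryVaughan2007] H. L. Montgomery, R. C. Vaughan, *Multiplicative Number Theory I*, CUP 2007,
  §8.4, proof of Thm. 8.10 (p. 268 of the printed book; read).
-/

noncomputable section

open Set Filter MeasureTheory
open scoped Topology ENNReal NNReal

namespace Literature.NumberTheory.BeurlingPrimes

open Literature.Barriers.RiemannHypothesis

variable (P : BeurlingPrimes)

/-! ### Size of generalized integers -/

/-- `λ₀ ≤ genInt k` for `k ≠ 0`. [folklore] -/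
theorem _root_.Literature.Barriers.RiemannHypothesis.BeurlingPrimes.prime_zero_le_genInt
    {k : ℕ →₀ ℕ} (hk : k ≠ 0) : P.prime 0 ≤ P.genInt k := by
  obtain ⟨j, hj⟩ : ∃ j, k j ≠ 0 := by
    by_contra h
    push Not at h
    exact hk (Finsupp.ext h)
  exact (P.mono (Nat.zero_le j)).trans (P.prime_le_of_genInt_le le_rfl hj)

/-- `genInt k > 1` for `k ≠ 0`. [folklore] -/
theorem _root_.Literature.Barriers.RiemannHypothesis.BeurlingPrimes.one_lt_genInt {k : ℕ →₀ ℕ}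
    (hk : k ≠ 0) : 1 < P.genInt k :=
  lt_of_lt_of_le P.one_lt (P.prime_zero_le_genInt hk)

/-! ### `N_P` as a sum over all exponent vectors -/

/-- `∑_k 1[genInt k ≤ x] · c = N_P(x) · c` (in any topological semiring, e.g. `ℝ≥0∞`, `ℂ`; the
sum is finite: tree `Hilberdink.hasSum_indicator_intCount`). [folklore] -/
theorem _root_.Literature.Barriers.RiemannHypothesis.BeurlingPrimes.tsum_ite_genInt_le
    {R : Type*} [NonAssocSemiring R] [TopologicalSpace R] [T2Space R] (x : ℝ) (c : R) :
    ∑' k : ℕ →₀ ℕ, (if P.genInt k ≤ x then c else 0) = P.intCount x * c := by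
  rw [(Hilberdink.hasSum_indicator_intCount P x c).tsum_eq, nsmul_eq_mul]

/-! ### `∑ (genInt k)^{−σ} = ∫₁^∞ N_P(x) σ x^{−σ−1} dx` and convergence for `σ > 1` -/

/-- `∫₁^∞ 1[g ≤ x] σ x^{−σ−1} dx = g^{−σ}` for `g ≥ 1`, `σ > 0` (in `ℝ≥0∞`). [folklore] -/
theorem lintegral_ite_le_rpow {g σ : ℝ} (hg : 1 ≤ g) (hσ : 0 < σ) :
    ∫⁻ x in Ioi (1 : ℝ), (if g ≤ x then ENNReal.ofReal (σ * x ^ (-σ - 1)) else 0) =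
      ENNReal.ofReal (g ^ (-σ)) := by
  have h1 : (fun x : ℝ ↦ if g ≤ x then ENNReal.ofReal (σ * x ^ (-σ - 1)) else 0) =
      (Ici g).indicator fun x ↦ ENNReal.ofReal (σ * x ^ (-σ - 1)) := by
    funext x
    simp [Set.indicator_apply, mem_Ici]
  rw [h1, lintegral_indicator measurableSet_Ici, Measure.restrict_restrict measurableSet_Ici]
  have hae : (Ici g ∩ Ioi (1 : ℝ) : Set ℝ) =ᵐ[volume] Ioi g := by
    rcases hg.lt_or_eq with hlt | heq
    · rw [inter_eq_left.mpr (Ici_subset_Ioi.mpr hlt)]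
      exact Ioi_ae_eq_Ici.symm
    · rw [← heq, inter_eq_right.mpr Ioi_subset_Ici_self]
  rw [Measure.restrict_congr_set hae]
  have hg0 : 0 < g := by linarith
  have hint : IntegrableOn (fun x : ℝ ↦ σ * x ^ (-σ - 1)) (Ioi g) :=
    (integrableOn_Ioi_rpow_of_lt (by linarith) hg0).const_mul σ
  have hnn : 0 ≤ᵐ[volume.restrict (Ioi g)] fun x : ℝ ↦ σ * x ^ (-σ - 1) := by
    rw [EventuallyLE, ae_restrict_iff' measurableSet_Ioi]
    exact Eventually.of_forall fun x hx ↦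
      mul_nonneg hσ.le (Real.rpow_nonneg (le_of_lt (lt_trans hg0 hx)) _)
  rw [← ofReal_integral_eq_lintegral_ofReal hint hnn, integral_const_mul,
    integral_Ioi_rpow_of_lt (by linarith) hg0]
  congr 1
  have hσ1 : -σ - 1 + 1 = -σ := by ring
  rw [hσ1]
  field_simp

/-- **`∑_k (genInt k)^{−σ} = ∫₁^∞ N_P(x) σ x^{−σ−1} dx`** for `σ > 0`, in `ℝ≥0∞` (Tonelli; both sides
may be infinite): the integer-side Stieltjes integral `∫_{1⁻}^∞ x^{−σ} dN_P(x)` integrated by parts.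
[cite: MontgomeryVaughan2007, §8.4, proof of Thm 8.10] -/
theorem _root_.Literature.Barriers.RiemannHypothesis.BeurlingPrimes.tsum_ofReal_genInt_rpow_eq_lintegral
    {σ : ℝ} (hσ : 0 < σ) :
    ∑' k : ℕ →₀ ℕ, ENNReal.ofReal (P.genInt k ^ (-σ)) =
      ∫⁻ x in Ioi (1 : ℝ), (P.intCount x : ℝ≥0∞) * ENNReal.ofReal (σ * x ^ (-σ - 1)) := by
  have h1 : ∀ k : ℕ →₀ ℕ, ENNReal.ofReal (P.genInt k ^ (-σ)) =
      ∫⁻ x in Ioi (1 : ℝ), (if P.genInt k ≤ x then ENNReal.ofReal (σ * x ^ (-σ - 1)) else 0) :=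
    fun k ↦ (lintegral_ite_le_rpow (P.one_le_genInt k) hσ).symm
  simp_rw [h1]
  have hmeas : ∀ k : ℕ →₀ ℕ, Measurable fun x : ℝ ↦
      (if P.genInt k ≤ x then ENNReal.ofReal (σ * x ^ (-σ - 1)) else 0) := by
    intro k
    refine Measurable.ite measurableSet_Ici ?_ measurable_const
    exact ENNReal.measurable_ofReal.comp (measurable_const.mul (measurable_id.pow_const _))
  rw [← lintegral_tsum fun k ↦ (hmeas k).aemeasurable]
  exact lintegral_congr fun x ↦ P.tsum_ite_genInt_le x _

/-- **Convergence of `∑_k (genInt k)^{−σ}` for `σ > 1` from `N_P(x) ≤ Kx`** (the primes satisfy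
`∑_j λ_j^{−σ} < ∞`, tree `Hilberdink.summable_prime_rpow`, and then the integers do by the Euler product,
tree `summable_norm_genInt_cpow`). [cite: MontgomeryVaughan2007, §8.4, proof of Thm 8.10] -/
theorem _root_.Literature.Barriers.RiemannHypothesis.BeurlingPrimes.summable_genInt_rpow {K σ : ℝ}
    (hK : ∀ x : ℝ, 1 ≤ x → (P.intCount x : ℝ) ≤ K * x) (hσ : 1 < σ) :
    Summable fun k : ℕ →₀ ℕ ↦ P.genInt k ^ (-σ) := by
  have hprime : Summable fun j ↦ P.prime j ^ (-((σ : ℂ)).re) := by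
    simpa using Hilberdink.summable_prime_rpow P hK hσ
  have h := P.summable_norm_genInt_cpow (s := (σ : ℂ)) (by simp; linarith) hprime
  refine h.congr fun k ↦ ?_
  rw [Complex.norm_cpow_eq_rpow_re_of_pos (P.genInt_pos k)]
  simp

end Literature.NumberTheory.BeurlingPrimes

end
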